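import Literature.Analysis.Calculus.MonomialUnits
import Literature.Algebra.Polynomial.ConjugatePairProducts
import Mathlib.Analysis.Calculus.FDeriv.Analytic
import HarnessLib

/-!
# Jung's projection method: binomial normal form of `∏_l (t − ζ_l)^{k_l}` along a slab chart

The last bookkeeping step of Jung's preparation. Over a box `(−δ, 1+δ)ᵈ` let `ζ_l` be root
functions with conjugation involution `τ`, real walls `W_m = re ζ_{r m}` (`m < p`), `τ`-invariant
exponents `k_l`, wall assignment `re ζ_l = W_{μ l}` for the non-real roots that occur, wall
differences `W_{m'} − W_m = σ^β · u` (`u > 0` analytic) and imaginary parts `im ζ_l = σ^β · v`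
(`v ≠ 0` analytic). Along the slab chart `t(z) = W_K(z') + z_d (W_{K+1}(z') − W_K(z'))` the real
number `y` with `y = ∏_l (t − ζ_l(z'))^{k_l}` takes, after multiplication by a constant `κ ≠ 0`, the
BINOMIAL PRODUCT FORM
`(cube-monomial · unit) · ∏ (M₁e₁ + M₂e₂)^{m} · ∏ ((M₃e₃ + M₄e₄)² + M₅e₅)^{m'}`
with cube-monomials `M(x) = ∏ x_i^{a_i} (1 − x_i)^{b_i}` of `ℝᵈ⁺¹` and positive analytic units on a
neighbourhood of the closed unit cube (`exists_binomial_form`). Real roots give the factors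
`t − W_m = ±((W_K − W_m) + z_d · gap)` etc., conjugate pairs give `(t − re ζ)² + (im ζ)²`.
Namespace `Literature.NumberTheory.Transcendental.JungPreparation`.

## References

* J. Kollár, *Lectures on Resolution of Singularities* (2007), §2.3; E. Bierstone, P. Milman,
  Publ. Math. IHÉS 67 (1988), §4.
-/

noncomputable section

open Set
open scoped ComplexConjugate
open Literature.Analysis.Calculus
open Literature.Algebra.Polynomial

namespace Literature.NumberTheory.Transcendental.JungPreparation

variable {d : ℕ}

/-- A cube-monomial of `ℝᵈ⁺¹` whose exponents are `(β, c₁)` and `(0, c₂)`: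
`∏_{i<d} z_i^{β_i} · z_d^{c₁} (1 − z_d)^{c₂}`. [folklore] -/
theorem prod_snoc_pow (z : Fin (d + 1) → ℝ) (β : Fin d → ℕ) (c₁ c₂ : ℕ) :
    (∏ i, z i ^ (Fin.snoc β c₁ : Fin (d + 1) → ℕ) i * (1 - z i) ^ (Fin.snoc (0 : Fin d → ℕ) c₂ : Fin (d + 1) → ℕ) i) =
      (∏ i, Fin.init z i ^ β i) * (z (Fin.last d) ^ c₁ * (1 - z (Fin.last d)) ^ c₂) := by
  rw [Fin.prod_univ_castSucc]
  simp only [Fin.snoc_castSucc, Fin.snoc_last, Pi.zero_apply, pow_zero, mul_one]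
  rfl

/-- The trivial cube-monomial. [folklore] -/
theorem prod_pow_zero_mul (z : Fin (d + 1) → ℝ) :
    (∏ i, z i ^ (0 : Fin (d + 1) → ℕ) i * (1 - z i) ^ (0 : Fin (d + 1) → ℕ) i) = 1 := by simp

/-- `z ↦ g (init z)` is analytic where `g` is analytic at `init z`. [folklore] -/
theorem analyticOnNhd_comp_init {g : (Fin d → ℝ) → ℝ} {V : Set (Fin d → ℝ)} (hg : AnalyticOnNhd ℝ g V) :
    AnalyticOnNhd ℝ (fun z : Fin (d + 1) → ℝ => g (Fin.init z)) {z | Fin.init z ∈ V} := by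
  intro z hz
  let initL : (Fin (d + 1) → ℝ) →L[ℝ] (Fin d → ℝ) :=
    ContinuousLinearMap.pi fun j => ContinuousLinearMap.proj (Fin.castSucc j)
  have hinitL : ∀ v, initL v = Fin.init v := fun v => rfl
  exact (hinitL z ▸ hg _ hz).comp (initL.analyticAt z)

/-- The cylinder over an open box is open and contains the closed unit cube. [folklore] -/
theorem isOpen_setOf_init_mem_box {δ : ℝ} (hδ : 0 < δ) :
    IsOpen {z : Fin (d + 1) → ℝ | Fin.init z ∈ Set.pi Set.univ (fun _ : Fin d => Ioo (-δ) (1 + δ))} ∧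
      Set.pi Set.univ (fun _ : Fin (d + 1) => Icc (0 : ℝ) 1) ⊆
        {z : Fin (d + 1) → ℝ | Fin.init z ∈ Set.pi Set.univ (fun _ : Fin d => Ioo (-δ) (1 + δ))} := by
  refine ⟨(isOpen_set_pi finite_univ fun _ _ => isOpen_Ioo).preimage
    (continuous_pi fun j => continuous_apply (Fin.castSucc j)), fun z hz => ?_⟩
  exact pi_Icc_subset_box hδ (fun j _ => hz (Fin.castSucc j) (mem_univ _))

/-- **Binomial normal form along a slab chart.** See the module docstring (Kollár 2007, §2.3;
Bierstone–Milman 1988, §4). The conclusion is literally the per-chart clause of the binomial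
preparation `PREP(d)` of the cube-monomialisation skeleton, for every real `y` with
`y = ∏_l (t(z) − ζ_l(z'))^{k_l}` (as complex numbers), multiplied by the constant `κ`. [folklore] -/
theorem exists_binomial_form {n p : ℕ} {δ : ℝ} (hδ : 0 < δ) (ζ : Fin n → (Fin d → ℝ) → ℂ)
    {τ : Fin n → Fin n} (hτinv : Function.Involutive τ)
    (hτ : ∀ l, ∀ σ ∈ Set.pi Set.univ (fun _ : Fin d => Ioo (-δ) (1 + δ)), conj (ζ l σ) = ζ (τ l) σ)
    {r : Fin p → Fin n} (hrinj : Function.Injective r) (hrfix : ∀ m, τ (r m) = r m)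
    (hrsurj : ∀ l, τ l = l → ∃ m, r m = l)
    (W : Fin p → (Fin d → ℝ) → ℝ)
    (hW : ∀ m, ∀ σ ∈ Set.pi Set.univ (fun _ : Fin d => Ioo (-δ) (1 + δ)), W m σ = (ζ (r m) σ).re)
    {k : Fin n → ℕ} (hk : ∀ l, k (τ l) = k l) (μ : Fin n → Fin p)
    (hμ : ∀ l, τ l ≠ l → 0 < k l → ∀ σ ∈ Set.pi Set.univ (fun _ : Fin d => Ioo (-δ) (1 + δ)),
      (ζ l σ).re = W (μ l) σ)
    (βd : Fin p → Fin p → Fin d → ℕ) (ud : Fin p → Fin p → (Fin d → ℝ) → ℝ)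
    (huda : ∀ m m', m < m' → AnalyticOnNhd ℝ (ud m m') (Set.pi Set.univ (fun _ : Fin d => Ioo (-δ) (1 + δ))))
    (hudpos : ∀ m m', m < m' → ∀ σ ∈ Set.pi Set.univ (fun _ : Fin d => Ioo (-δ) (1 + δ)), 0 < ud m m' σ)
    (hud : ∀ m m', m < m' → ∀ σ ∈ Set.pi Set.univ (fun _ : Fin d => Ioo (-δ) (1 + δ)),
      W m' σ - W m σ = (∏ i, σ i ^ βd m m' i) * ud m m' σ)
    (βi : Fin n → Fin d → ℕ) (vi : Fin n → (Fin d → ℝ) → ℝ)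
    (hvia : ∀ l, τ l ≠ l → AnalyticOnNhd ℝ (vi l) (Set.pi Set.univ (fun _ : Fin d => Ioo (-δ) (1 + δ))))
    (hvi0 : ∀ l, τ l ≠ l → ∀ σ ∈ Set.pi Set.univ (fun _ : Fin d => Ioo (-δ) (1 + δ)), vi l σ ≠ 0)
    (hvi : ∀ l, τ l ≠ l → ∀ σ ∈ Set.pi Set.univ (fun _ : Fin d => Ioo (-δ) (1 + δ)),
      (ζ l σ).im = (∏ i, σ i ^ βi l i) * vi l σ)
    (κ : ℝ) (hκ : κ ≠ 0) {K : ℕ} (hK : K + 1 < p) :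
    ∃ U : Set (Fin (d + 1) → ℝ), IsOpen U ∧ Set.pi Set.univ (fun _ : Fin (d + 1) => Set.Icc (0:ℝ) 1) ⊆ U ∧
      ∃ (a₀ b₀ : Fin (d + 1) → ℕ) (e₀ : (Fin (d + 1) → ℝ) → ℝ) (L₁ L₂ : ℕ) (m₁ : Fin L₁ → ℕ)
        (a₁ b₁ a₂ b₂ : Fin L₁ → Fin (d + 1) → ℕ) (e₁ e₂ : Fin L₁ → (Fin (d + 1) → ℝ) → ℝ)
        (m₂ : Fin L₂ → ℕ) (a₃ b₃ a₄ b₄ a₅ b₅ : Fin L₂ → Fin (d + 1) → ℕ)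
        (e₃ e₄ e₅ : Fin L₂ → (Fin (d + 1) → ℝ) → ℝ),
        AnalyticOnNhd ℝ e₀ U ∧ (∀ x ∈ U, e₀ x ≠ 0) ∧
        (∀ l, AnalyticOnNhd ℝ (e₁ l) U ∧ AnalyticOnNhd ℝ (e₂ l) U ∧ ∀ x ∈ U, 0 < e₁ l x ∧ 0 < e₂ l x) ∧
        (∀ l, AnalyticOnNhd ℝ (e₃ l) U ∧ AnalyticOnNhd ℝ (e₄ l) U ∧ AnalyticOnNhd ℝ (e₅ l) U ∧
          ∀ x ∈ U, 0 < e₃ l x ∧ 0 < e₄ l x ∧ 0 < e₅ l x) ∧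
        ∀ x ∈ U, ∀ y : ℝ, (y : ℂ) = ∏ l, (((W ⟨K, Nat.lt_of_succ_lt hK⟩ (Fin.init x) + x (Fin.last d) *
            (W ⟨K + 1, hK⟩ (Fin.init x) - W ⟨K, Nat.lt_of_succ_lt hK⟩ (Fin.init x)) : ℝ) : ℂ) -
              ζ l (Fin.init x)) ^ k l →
          κ * y = (∏ i, x i ^ a₀ i * (1 - x i) ^ b₀ i) * e₀ x *
            (∏ l, ((∏ i, x i ^ a₁ l i * (1 - x i) ^ b₁ l i) * e₁ l x +
              (∏ i, x i ^ a₂ l i * (1 - x i) ^ b₂ l i) * e₂ l x) ^ m₁ l) *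
            ∏ l, (((∏ i, x i ^ a₃ l i * (1 - x i) ^ b₃ l i) * e₃ l x +
              (∏ i, x i ^ a₄ l i * (1 - x i) ^ b₄ l i) * e₄ l x) ^ 2 +
              (∏ i, x i ^ a₅ l i * (1 - x i) ^ b₅ l i) * e₅ l x) ^ m₂ l := by
  classical
  set Bx := Set.pi Set.univ (fun _ : Fin d => Ioo (-δ) (1 + δ)) with hBx
  set U : Set (Fin (d + 1) → ℝ) := {z | Fin.init z ∈ Bx} with hU
  obtain ⟨hUo, hcubeU⟩ := isOpen_setOf_init_mem_box (d := d) hδ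
  set Kf : Fin p := ⟨K, Nat.lt_of_succ_lt hK⟩ with hKf
  set Kf1 : Fin p := ⟨K + 1, hK⟩ with hKf1
  have hKK1 : Kf < Kf1 := Fin.mk_lt_mk.2 K.lt_succ_self
  set βG := βd Kf Kf1 with hβG
  set G := ud Kf Kf1 with hG
  -- ### the two-term data of the factors `t − W_m`, by position of `m` relative to `K`
  set A1 : Fin p → Fin (d + 1) → ℕ := fun m => if (m : ℕ) < K then Fin.snoc (βd m Kf) 0
    else if (m : ℕ) = K then Fin.snoc βG 1 else if (m : ℕ) = K + 1 then Fin.snoc βG 0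
    else Fin.snoc (βd Kf1 m) 0 with hA1
  set B1 : Fin p → Fin (d + 1) → ℕ := fun m => if (m : ℕ) < K then Fin.snoc 0 0
    else if (m : ℕ) = K then Fin.snoc 0 0 else if (m : ℕ) = K + 1 then Fin.snoc 0 1
    else Fin.snoc 0 0 with hB1
  set E1 : Fin p → (Fin (d + 1) → ℝ) → ℝ := fun m z => if (m : ℕ) < K then ud m Kf (Fin.init z)
    else if (m : ℕ) = K then G (Fin.init z) / 2 else if (m : ℕ) = K + 1 then G (Fin.init z) / 2
    else ud Kf1 m (Fin.init z) with hE1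
  set A2 : Fin p → Fin (d + 1) → ℕ := fun m => if (m : ℕ) < K then Fin.snoc βG 1
    else if (m : ℕ) = K then Fin.snoc βG 1 else if (m : ℕ) = K + 1 then Fin.snoc βG 0
    else Fin.snoc βG 0 with hA2
  set B2 : Fin p → Fin (d + 1) → ℕ := fun m => if (m : ℕ) < K then Fin.snoc 0 0
    else if (m : ℕ) = K then Fin.snoc 0 0 else if (m : ℕ) = K + 1 then Fin.snoc 0 1
    else Fin.snoc 0 1 with hB2
  set E2 : Fin p → (Fin (d + 1) → ℝ) → ℝ := fun m z => if (m : ℕ) < K then G (Fin.init z)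
    else if (m : ℕ) = K then G (Fin.init z) / 2 else if (m : ℕ) = K + 1 then G (Fin.init z) / 2
    else G (Fin.init z) with hE2
  set sg : Fin p → ℝ := fun m => if (m : ℕ) < K then 1 else if (m : ℕ) = K then 1 else -1 with hsg
  set TT : Fin p → (Fin (d + 1) → ℝ) → ℝ := fun m z =>
    (∏ i, z i ^ A1 m i * (1 - z i) ^ B1 m i) * E1 m z + (∏ i, z i ^ A2 m i * (1 - z i) ^ B2 m i) * E2 m z
    with hTT
  have hsg_sq : ∀ m, sg m ^ 2 = 1 := fun m => by simp only [hsg]; split_ifs <;> norm_num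
  have hsg_ne : ∀ m, sg m ≠ 0 := fun m => by simp only [hsg]; split_ifs <;> norm_num
  -- ### pointwise: `t − W_m = sg_m · TT_m`
  have hfac : ∀ z ∈ U, ∀ m : Fin p,
      W Kf (Fin.init z) + z (Fin.last d) * (W Kf1 (Fin.init z) - W Kf (Fin.init z)) - W m (Fin.init z) =
        sg m * TT m z := by
    intro z hz m
    have hgap := hud Kf Kf1 hKK1 _ hz
    simp only [hTT, hA1, hB1, hE1, hA2, hB2, hE2, hsg]
    by_cases h1 : (m : ℕ) < K
    · have hmK : m < Kf := Fin.lt_def.2 h1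
      have hdm := hud m Kf hmK _ hz
      simp only [h1, if_true, prod_snoc_pow, pow_zero, pow_one, mul_one, one_mul]
      rw [← hβG, ← hG] at hgap
      linear_combination hdm + z (Fin.last d) * hgap
    · by_cases h2 : (m : ℕ) = K
      · have hmK : m = Kf := Fin.ext h2
        subst hmK
        have hv : ((Kf : Fin p) : ℕ) = K := rfl
        simp only [hv, lt_self_iff_false, if_false, if_true, prod_snoc_pow, pow_zero, pow_one,
          mul_one, one_mul]
        rw [← hβG, ← hG] at hgap
        linear_combination z (Fin.last d) * hgap
      · by_cases h3 : (m : ℕ) = K + 1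
        · have hmK : m = Kf1 := Fin.ext h3
          subst hmK
          have hv : ((Kf1 : Fin p) : ℕ) = K + 1 := rfl
          have hc1 : ¬(K + 1 < K) := by omega
          have hc2 : (K + 1 = K) ↔ False := ⟨fun h => by omega, False.elim⟩
          simp only [hv, hc1, hc2, if_false, if_true, prod_snoc_pow, pow_zero, pow_one, one_mul]
          rw [← hβG, ← hG] at hgap
          linear_combination (z (Fin.last d) - 1) * hgap
        · have hmK : Kf1 < m := by
            rw [Fin.lt_def]
            simp only [hKf1]
            omega
          have hdm := hud Kf1 m hmK _ hz
          simp only [h1, h2, h3, if_false, prod_snoc_pow, pow_zero, pow_one, mul_one, one_mul]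
          rw [← hβG, ← hG] at hgap
          linear_combination (-1 : ℝ) * hdm + (z (Fin.last d) - 1) * hgap
  -- ### analyticity and positivity of the units
  have hE : ∀ m, AnalyticOnNhd ℝ (E1 m) U ∧ AnalyticOnNhd ℝ (E2 m) U ∧ ∀ x ∈ U, 0 < E1 m x ∧ 0 < E2 m x := by
    intro m
    have hGa : AnalyticOnNhd ℝ (fun z : Fin (d + 1) → ℝ => G (Fin.init z)) U :=
      analyticOnNhd_comp_init (huda Kf Kf1 hKK1)
    have hGa2 : AnalyticOnNhd ℝ (fun z : Fin (d + 1) → ℝ => G (Fin.init z) / 2) U :=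
      hGa.div analyticOnNhd_const fun _ _ => two_ne_zero
    have hGpos : ∀ z ∈ U, 0 < G (Fin.init z) := fun z hz => hudpos Kf Kf1 hKK1 _ hz
    simp only [hE1, hE2]
    by_cases h1 : (m : ℕ) < K
    · simp only [h1, if_true]
      exact ⟨analyticOnNhd_comp_init (huda m Kf (Fin.lt_def.2 h1)), hGa,
        fun z hz => ⟨hudpos m Kf (Fin.lt_def.2 h1) _ hz, hGpos z hz⟩⟩
    · by_cases h2 : (m : ℕ) = K
      · simp only [h2, lt_self_iff_false, if_false, if_true]
        exact ⟨hGa2, hGa2, fun z hz => ⟨half_pos (hGpos z hz), half_pos (hGpos z hz)⟩⟩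
      · by_cases h3 : (m : ℕ) = K + 1
        · have hc1 : ¬(K + 1 < K) := by omega
          have hc2 : (K + 1 = K) ↔ False := ⟨fun h => by omega, False.elim⟩
          simp only [h3, hc1, hc2, if_false, if_true]
          exact ⟨hGa2, hGa2, fun z hz => ⟨half_pos (hGpos z hz), half_pos (hGpos z hz)⟩⟩
        · have hmK : Kf1 < m := by
            rw [Fin.lt_def]
            simp only [hKf1]
            omega
          simp only [h1, h2, h3, if_false]
          exact ⟨analyticOnNhd_comp_init (huda Kf1 m hmK), hGa,
            fun z hz => ⟨hudpos Kf1 m hmK _ hz, hGpos z hz⟩⟩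
  -- ### representatives of conjugate pairs
  set Rep : Finset (Fin n) := Finset.univ.filter fun l => τ l ≠ l ∧ l < τ l with hRep
  set L₂ := Rep.card with hL₂
  set rep : Fin L₂ → Fin n := fun i => (Rep.equivFin.symm i).1 with hrep
  have hrepmem : ∀ i, rep i ∈ Rep := fun i => (Rep.equivFin.symm i).2
  have hrepτ : ∀ i, τ (rep i) ≠ rep i := fun i => (Finset.mem_filter.1 (hrepmem i)).2.1
  have hreindex : ∀ g : Fin n → ℝ, ∏ l ∈ Rep, g l = ∏ i : Fin L₂, g (rep i) := fun g => by
    rw [← Finset.prod_coe_sort Rep, Fintype.prod_equiv Rep.equivFin.symm (fun i => g (rep i))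
      (fun j => g j) (fun i => rfl)]
  -- ### the data
  refine ⟨U, hUo, hcubeU, 0, 0, fun _ => κ * ∏ m, sg m ^ k (r m), p, L₂, fun m => k (r m),
    A1, B1, A2, B2, E1, E2, fun i => k (rep i), fun i => A1 (μ (rep i)), fun i => B1 (μ (rep i)),
    fun i => A2 (μ (rep i)), fun i => B2 (μ (rep i)), fun i => Fin.snoc (2 • βi (rep i)) 0,
    fun _ => Fin.snoc 0 0, fun i => E1 (μ (rep i)), fun i => E2 (μ (rep i)),
    fun i z => vi (rep i) (Fin.init z) ^ 2, analyticOnNhd_const,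
    fun x _ => mul_ne_zero hκ (Finset.prod_ne_zero_iff.2 fun m _ => pow_ne_zero _ (hsg_ne m)),
    fun m => hE m, fun i => ⟨(hE _).1, (hE _).2.1, ?_, fun x hx => ⟨((hE _).2.2 x hx).1,
      ((hE _).2.2 x hx).2, pow_pos (abs_pos.2 (hvi0 _ (hrepτ i) _ hx)) 2 |>.trans_eq (by rw [sq_abs])⟩⟩,
    fun z hz y hy => ?_⟩
  · exact ((analyticOnNhd_comp_init (hvia _ (hrepτ i))).pow 2)
  · -- ### the identity
    set σ := Fin.init z with hσ
    set t : ℝ := W Kf σ + z (Fin.last d) * (W Kf1 σ - W Kf σ) with ht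
    have hzτ : ∀ l, ζ (τ l) σ = conj (ζ l σ) := fun l => (hτ l σ hz).symm
    have hmain := prod_pow_sub_eq_ofReal (z := fun l => ζ l σ) hτinv hzτ hk t
    have hy' : y = (∏ l ∈ Finset.univ.filter (fun l => τ l = l), (t - (ζ l σ).re) ^ k l) *
        ∏ l ∈ Rep, ((t - (ζ l σ).re) ^ 2 + (ζ l σ).im ^ 2) ^ k l :=
      Complex.ofReal_injective (hy.trans hmain)
    -- real roots: reindex by the walls
    have hFix : (Finset.univ.filter fun l => τ l = l) = Finset.univ.image r := by
      ext l
      simp only [Finset.mem_filter, Finset.mem_univ, true_and, Finset.mem_image]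
      exact ⟨fun h => hrsurj l h, fun ⟨m, hm⟩ => hm ▸ hrfix m⟩
    have hA : ∏ l ∈ Finset.univ.filter (fun l => τ l = l), (t - (ζ l σ).re) ^ k l =
        (∏ m, sg m ^ k (r m)) * ∏ m, TT m z ^ k (r m) := by
      rw [hFix, Finset.prod_image fun m _ m' _ h => hrinj h, ← Finset.prod_mul_distrib]
      refine Finset.prod_congr rfl fun m _ => ?_
      rw [← mul_pow, ← hfac z hz m, hW m σ hz]
    -- conjugate pairs
    have hB : ∏ l ∈ Rep, ((t - (ζ l σ).re) ^ 2 + (ζ l σ).im ^ 2) ^ k l =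
        ∏ i : Fin L₂, (TT (μ (rep i)) z ^ 2 +
          (∏ j, z j ^ (Fin.snoc (2 • βi (rep i)) 0 : Fin (d + 1) → ℕ) j *
            (1 - z j) ^ (Fin.snoc (0 : Fin d → ℕ) 0 : Fin (d + 1) → ℕ) j) * vi (rep i) (Fin.init z) ^ 2) ^
          k (rep i) := by
      rw [hreindex fun l => ((t - (ζ l σ).re) ^ 2 + (ζ l σ).im ^ 2) ^ k l]
      refine Finset.prod_congr rfl fun i _ => ?_
      by_cases hk0 : k (rep i) = 0
      · simp only [hk0, pow_zero]
      · have hre := hμ (rep i) (hrepτ i) (Nat.pos_of_ne_zero hk0) σ hz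
        have him := hvi (rep i) (hrepτ i) σ hz
        congr 1
        rw [hre, hfac z hz, mul_pow, hsg_sq, one_mul, him, prod_snoc_pow, mul_pow]
        simp only [pow_zero, mul_one, Pi.smul_apply, smul_eq_mul, pow_mul', Finset.prod_pow, ← hσ]
    rw [hy', hA, hB]
    simp only [hTT, prod_pow_zero_mul, one_mul]
    ring

end Literature.NumberTheory.Transcendental.JungPreparation
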